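import Literature.NumberTheory.EllipticCurves.Rank1Residual.Typed.Basic

/-!
# Sketch — the real-quadratic frame for «kato-bottom-layer-exczero» (J2b), bookkeeping only
(planner-bsd-idea-9-g32; companion of `Lines/kato_bottom_layer_Fframe.md` and of the g31 sketch
`KatoBottomLayerExcZeroSketch.lean`; nothing here is a route item,
a stub or a registered line; no statement of number theory is proved — the content sits in the hypotheses,
each of which is a printed identity, a port, or the constant audit named in the memo.)

Valuations at one pair `(E, p)` (`p` split multiplicative, the only multiplicative prime; `ord_p` throughout):
* `vq` — `ord_p Ш_an(E)`;  `c` — `ord_p c_p(E) = ord_p(ord_p q_E)`;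
* `vl` — `ord_p ℓ` (Bertolini–Darmon/Mok's rational constant `l''`, Venerucci Thm 2.1);
* `vP`, `vx` — `ord_p log_E(P)` (Mok's Heegner point over the CM field `K/F`) and `ord_p log_E(x)` (generator);
* `v`  — `ord_p( log_E(res_p z_ℚ) / log_E(x)² )` (the quantity `hC` of the g31 sketch is about);
* `vd` — `ord_p δ_X` (Shimura degree of `Pic⁰(X_𝐁(𝔫⁺)) → E` over `F`);  `vPhi` — `ord_p ⟨Φ_E,Φ_E⟩` (Gross pairing on `B_{∞₁∞₂}`);
* `vL` — `ord_p( L'(E,1) / (Ω_E · ĥ(x)) )`;  `κ` — valuation of the explicit closed-form constant of the unwinding.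
Hypotheses: `hVen` = Venerucci Thm A with `ℓ₁ = −2ℓ·ord_p(q_E)·(1−p⁻¹)` [arXiv:1407.1913 p.25];
`hU` = the unwinding (U) of the memo §4 (Mok (5.7),(5.15),(6.3),(6.7),(6.11) × Cai–Shu–Tian Thm 1.5 special case 1);
`hT` = Takahashi's character-group identity at the discriminant prime `𝔭 | p` of `𝐁`, ported to `F` (`j_𝔭 = 1`);
`hS1b` = `Ш_an·∏_q c_q/#E(ℚ)²_tors` has valuation `vq + c` on S1b under `Surj`;  `hκ` = the constant audit.
-/

namespace Summit.BirchSwinnertonDyer.BirchSwinnertonDyer.Cruxes.EulerHalfNotRamNoInertSetAtFive.KatoBottomLayerFframe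

open Literature.NumberTheory.EllipticCurves Literature.NumberTheory.EllipticCurves.Rank1Residual.Typed

/-- The g31 bottom-layer composition, restated verbatim (its module `…/KatoBottomLayerExcZeroSketch.lean` is a crux
workfile, not a built target, so it cannot be imported here). -/
theorem missingUpperBoundAt_of_bottomLayer (W : WeierstrassCurve ℚ) (p : ℕ) [Fact p.Prime]
    (q : ℚ) (hq : shaAn W = (q : ℂ))
    (t e m c : ℕ) (v : ℤ)
    (hKim : (padicValNat p W.shaOrder : ℤ) + e ≤ t)
    (hidx : (t : ℤ) = v + e + 1 - c + m)
    (hC : v = padicValRat p q + c - 1)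
    (hm : m = 0) :
    MissingUpperBoundAt W p :=
  ⟨q, hq, by omega⟩

/-- J2b as bookkeeping: the four inputs of the real-quadratic frame give exactly the transfer statement `hC`
(`c_p` enters to the power `−1`, forced by `hT`). -/
theorem hC_of_Fframe (vq : ℤ) (c : ℕ) (v vl vP vx vd vPhi vL κ : ℤ)
    (hVen : v = (vl + c - 1) + 2 * vP - 2 * vx)
    (hU : vl + 2 * vP = vd - vPhi + vL + 2 * vx + κ)
    (hT : vd + c = vPhi)
    (hS1b : vL = vq + c)
    (hκ : κ = 0) :
    v = vq + c - 1 := by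
  omega

/-- The whole line at one pair, composed with the g31 bottom-layer lemma: Euler half on the sub-class `m = 0`. -/
theorem missingUpperBoundAt_of_Fframe (W : WeierstrassCurve ℚ) (p : ℕ) [Fact p.Prime]
    (q : ℚ) (hq : shaAn W = (q : ℂ))
    (t e m c : ℕ) (v vl vP vx vd vPhi vL κ : ℤ)
    (hKim : (padicValNat p W.shaOrder : ℤ) + e ≤ t)
    (hidx : (t : ℤ) = v + e + 1 - c + m)
    (hVen : v = (vl + c - 1) + 2 * vP - 2 * vx)
    (hU : vl + 2 * vP = vd - vPhi + vL + 2 * vx + κ)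
    (hT : vd + c = vPhi)
    (hS1b : vL = padicValRat p q + c)
    (hκ : κ = 0)
    (hm : m = 0) :
    MissingUpperBoundAt W p :=
  missingUpperBoundAt_of_bottomLayer W p q hq t e m c v hKim hidx
    (hC_of_Fframe (padicValRat p q) c v vl vP vx vd vPhi vL κ hVen hU hT hS1b hκ) hm

end Summit.BirchSwinnertonDyer.BirchSwinnertonDyer.Cruxes.EulerHalfNotRamNoInertSetAtFive.KatoBottomLayerFframe
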